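import Summits.BirchSwinnertonDyer.BirchSwinnertonDyer.Theorems.PrintX11aUpperNonSurjThreeSharpLocal
import HarnessLib

/-!
# Route `PrintX11a`, child crux U3 = `PrintX11a.UpperNonSurjThree` (item stmt-BirchSwinnertonDyer-20613),
# line «finemu3» — the local ♯-groups `B_v` MADE EXPLICIT at every place: a class dies under
# `H¹(H, E[p]) → H¹(H, E[p^∞])` iff it is the KUMMER CLASS `σ ↦ σ•b − b` of a point `b ∈ E[p^∞]` whose multiple `p•b` is
# `H`-fixed (`H = Gal(K̄/K_∞) ⊓ D_v`: «`b` is a `p`-division point of an `E(K_{v,∞})[p^∞]`-point»); so the engine's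
# paper step «explicit `B_v`» (REF V14) reduces to the bookkeeping of `E(K_{v,∞})[p^∞]` (q-Tate torsion at a split `v = p`)
# (cell `bsd-print-x11a`, width seat `bsd-line-x11a-p1-w2`; `--supports` 20613; closes nothing)

HONEST FRAMING.  BSD is not proved by any of this; nothing is asserted about any curve; `stub_conjA_three` stays OPEN.
THEOREMS ONLY (no definition, no named fact, no `sorry`), all PROVED — the cocycle bookkeeping of Greenberg's Kummer
sequence `0 → E(L)[p^∞]/p → H¹(L, E[p]) → H¹(L, E[p^∞])[p] → 0`, extracted from the tree's proof of
`finite_ker_torsionToPrimaryH1Sub` and stated for records/engines.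

* §1 (any field, any subgroup `H ≤ Γ_K`, any `W`): `ι[φ] = 0` ⟺ there is `b ∈ E[p^∞]` with `p•b` fixed by `H` and
  `φ(σ) = σ•b − b` for all `σ ∈ H` (`exists_kummer_of_torsionToPrimaryH1Sub_eq_zero`, and the converse
  `torsionToPrimaryH1Sub_eq_zero_of_kummer`).  So `B_v = ker(H¹(K_v,E[p]) → H¹(K_{v,∞}, E[p^∞]))` consists, after
  restriction to `Gal(K̄/K_∞) ⊓ D_v`, exactly of the Kummer classes of the `p`-division points `b` of the points of
  `E[p^∞]` rational over the local cyclotomic tower: the classical description `E(K_{v,∞})[p^∞]/p ↪ H¹(K_{v,∞}, E[p])`.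
* §2 (number field, any `κ`): for `y ∈ H¹(K, E[p])` with `ι(res_{K_∞} y) ∈ Sel₀(K_∞, E[p^∞])`, at EVERY finite place `v`
  some cocycle of `res_{Gal(K̄/K_∞) ⊓ D_v} y` is such a Kummer cocycle (`exists_kummer_of_mem_fineSelmerInfty`) — the local
  ♯-clause (b) of `…SharpLocal` in explicit form: «the extension cut out by `y` over `L_𝔴·K_{v,∞}` is generated by a
  `p`-division point of a tower-rational `p`-power torsion point» (at a split multiplicative `v = p`: Tate-curve
  division points of `q`; where the tower carries no `E`-torsion, `b ∈ E[p]` and the clause is `res = 0`,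
  `…SharpLocalNoTorsion`).

References: [GreenbergLNM1716] §3 Lemma 3.1 (proof: `B = E(F_∞)[p^∞]`, the Kummer sequence), Lemma 3.3 (`ker r_v`);
[LimSujatha2018] §3 (proof of Prop. 3.2, local terms); REF STATUS 2026-08-28T06:26:48Z (V14).
-/

set_option linter.dupNamespace false
set_option autoImplicit false

noncomputable section

open scoped Classical

open WeierstrassCurve Field NumberField IsDedekindDomain
  Literature.NumberTheory.EllipticCurves
  Literature.NumberTheory.EllipticCurves.GreenbergSelmer
  Literature.NumberTheory.EllipticCurves.Rank1Residual
  Literature.NumberTheory.GaloisRepresentations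
  Summit.BirchSwinnertonDyer.Rank1Residual

namespace Summit.BirchSwinnertonDyer.BirchSwinnertonDyer.Theorems.UpperNonSurjThreeSharp

/-! ### §1 The kernel of `ι : H¹(H, E[p]) → H¹(H, E[p^∞])` = Kummer classes of division points of `H`-fixed torsion -/

section AnyField

universe u

variable {K : Type u} [Field K] (W : WeierstrassCurve K) (p : ℕ) (H : Subgroup (absoluteGaloisGroup K))

/-- **`ι[φ] = 0` ⟹ `φ` is the Kummer cocycle of a `p`-division point of an `H`-fixed point of `E[p^∞]`**: there is
`b ∈ E[p^∞]` with `σ•(p•b) = p•b` for all `σ ∈ H` and `φ(σ) = σ•b − b` (as geometric points) for all `σ ∈ H`.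
(`ι[φ] = 0` means `ι∘φ = ∂b`; applying `p` kills `φ`, so `p•b` is `H`-fixed.)  Extracted from the tree's proof of
`finite_ker_torsionToPrimaryH1Sub`. [cite: GreenbergLNM1716, §3 proof of Lemma 3.1 (`B = E(F_∞)[p^∞]`)] -/
theorem exists_kummer_of_torsionToPrimaryH1Sub_eq_zero
    (φ : contOneCocycles (discreteTopRep H (geomTorsion W (p : ℤ))))
    (hφ : W.torsionToPrimaryH1Sub p H (oneCocycleClass _ φ) = 0) :
    ∃ b : geomPrimaryTorsion W p, (∀ σ : H, σ • (p • b) = p • b) ∧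
      ∀ σ : H, ((φ.1 σ : geomTorsion W (p : ℤ)) : geomPoints W) = ((σ • b - b : geomPrimaryTorsion W p) : geomPoints W) := by
  rw [torsionToPrimaryH1Sub_oneCocycleClass, oneCocycleClass_eq_zero_iff] at hφ
  obtain ⟨b, hb⟩ := hφ
  let incl := AddSubgroup.inclusion (geomTorsion_le_geomPrimaryTorsion W p)
  have hb' : ∀ σ : H, incl (φ.1 σ) = σ • b - b := fun σ ↦ hb σ
  refine ⟨b, fun σ ↦ ?_, fun σ ↦ ?_⟩
  · have h1 : p • (σ • b - b) = 0 := by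
      rw [← hb' σ, ← map_nsmul]
      have : p • φ.1 σ = 0 := Subtype.ext (by
        rw [AddSubgroupClass.coe_nsmul, ZeroMemClass.coe_zero]
        exact AddSubgroup.torsionBy.nsmul_iff.mp (φ.1 σ).2)
      rw [this, map_zero]
    rw [smul_sub, smul_comm, sub_eq_zero] at h1
    exact h1
  · have := congrArg (fun z : geomPrimaryTorsion W p ↦ (z : geomPoints W)) (hb' σ)
    simpa [incl] using this

/-- **Conversely, a Kummer cocycle of a `p`-division point of an `H`-fixed torsion point dies under `ι`**: if
`φ(σ) = σ•b − b` (as geometric points) for all `σ ∈ H`, then `ι[φ] = 0` (it is the coboundary of `b` in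
`E[p^∞]`-cohomology). [cite: GreenbergLNM1716, §3 proof of Lemma 3.1] -/
theorem torsionToPrimaryH1Sub_eq_zero_of_kummer
    (φ : contOneCocycles (discreteTopRep H (geomTorsion W (p : ℤ)))) (b : geomPrimaryTorsion W p)
    (hφ : ∀ σ : H, ((φ.1 σ : geomTorsion W (p : ℤ)) : geomPoints W) =
      ((σ • b - b : geomPrimaryTorsion W p) : geomPoints W)) :
    W.torsionToPrimaryH1Sub p H (oneCocycleClass _ φ) = 0 := by
  rw [torsionToPrimaryH1Sub_oneCocycleClass, oneCocycleClass_eq_zero_iff]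
  refine ⟨b, fun σ ↦ Subtype.ext ?_⟩
  change ((φ.1 σ : geomTorsion W (p : ℤ)) : geomPoints W) =
    ((σ • b - b : geomPrimaryTorsion W p) : geomPoints W)
  exact hφ σ

end AnyField

/-! ### §2 Number fields: the local ♯-clause of a fine class, in Kummer form, at every finite place -/

section NumberField

variable {K : Type} [Field K] [NumberField K] (W : WeierstrassCurve K) {p : ℕ} [Fact p.Prime]
  (κ : ZpExtension K p)

/-- **The local ♯-clause (b) in EXPLICIT Kummer form.**  For ANY `ℤ_p`-datum `κ` and `y ∈ H¹(K, E[p])` whose restriction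
to `K_∞` lands in `Sel₀(K_∞, E[p^∞])`, at every finite place `v`: every cocycle `φ` representing `res_{Gal(K̄/K_∞) ⊓ D_v} y`
is the Kummer cocycle `σ ↦ σ•b − b` of some `b ∈ E[p^∞]` whose multiple `p•b` is fixed by `Gal(K̄/K_∞) ⊓ D_v` — i.e.
`b` is a `p`-division point of a `p`-power torsion point of `E` rational over the local cyclotomic tower `K_{v,∞}`
(q-Tate division points at a split multiplicative `v = p`; `b ∈ E[p]` itself where the tower carries no `E`-torsion).
This is what an engine tests locally.  PROVED (`…SharpLocal` (b) + §1).
[cite: GreenbergLNM1716, §3 Lemmas 3.1 and 3.3 (`ker r_v`, the local Kummer kernels)] -/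
theorem exists_kummer_of_mem_fineSelmerInfty
    (y : discreteH1 (absoluteGaloisGroup K) (geomTorsion W (p : ℤ)))
    (hy : W.torsionToPrimaryH1Sub p κ.kerSubgroup
      (ResKernel.resSubgroup κ.kerSubgroup (geomTorsion W (p : ℤ)) y) ∈ W.fineSelmerInfty κ)
    (v : HeightOneSpectrum (𝓞 K))
    (φ : contOneCocycles (discreteTopRep (κ.kerSubgroup ⊓ decomp v : Subgroup (absoluteGaloisGroup K))
      (geomTorsion W (p : ℤ))))
    (hφ : oneCocycleClass _ φ = ResKernel.resSubgroup (κ.kerSubgroup ⊓ decomp v) (geomTorsion W (p : ℤ)) y) :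
    ∃ b : geomPrimaryTorsion W p,
      (∀ σ : (κ.kerSubgroup ⊓ decomp v : Subgroup (absoluteGaloisGroup K)), σ • (p • b) = p • b) ∧
      ∀ σ : (κ.kerSubgroup ⊓ decomp v : Subgroup (absoluteGaloisGroup K)),
        ((φ.1 σ : geomTorsion W (p : ℤ)) : geomPoints W) = ((σ • b - b : geomPrimaryTorsion W p) : geomPoints W) :=
  exists_kummer_of_torsionToPrimaryH1Sub_eq_zero W p (κ.kerSubgroup ⊓ decomp v) φ
    (by rw [hφ]; exact torsionToPrimaryH1Sub_resSubgroup_inf_decomp_eq_zero_of_mem_fineSelmerInfty W κ y hy v)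

end NumberField

end Summit.BirchSwinnertonDyer.BirchSwinnertonDyer.Theorems.UpperNonSurjThreeSharp

end
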